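/-
Origin: expansion seat `planner-pub-hodgecm-pv14-g5-0`, handover #8 2026-08-18T10:39:53Z (`HOME/pub-hodgecm-pv14-g5/lean/Pv14g5/WeilThetaModelHeisenbergWeyl.lean`, md5 b7312ece, 614 lines);
landed by the gen-7 packager in gate run 28 as `HodgeCM/Automorphic/WeilThetaModelHeisenbergWeyl.lean` (import ^import Pv14g5\.→import HodgeCM.Automorphic. ×1).
-/
/-
Origin: HOME/pub-hodgecm-pv14-g5/lean/Pv14g5/WeilThetaModelHeisenbergWeyl.lean — session planner-pub-hodgecm-pv14-g5-0
(unit pub-hodgecm-pv14-g5, DAG-node prover #14 gen 5).  Intended final place: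
`HodgeCM/Automorphic/WeilThetaModelHeisenbergWeyl.lean` (namespace `HodgeCM.SchwartzWeil`).
PACKAGER: rewrite `import Pv14g5.WeilThetaModelHeisenbergFourier` to
`import HodgeCM.Automorphic.WeilThetaModelHeisenbergFourier` (this seat's HANDOVER #6).
Asserts nothing (no `axiom`, no new constants).
-/
import Summits.HodgeConjecture.HodgeCM.Automorphic.WeilThetaModelHeisenbergFourier
import Mathlib.GroupTheory.SemidirectProduct

/-!
# The Weyl element ADJOINED: `Heis V ⋊ ⟨σ⟩` acts on `𝓢(V, ℂ)` by `(h, σⁿ) ↦ ρ_m(h) ∘ 𝓕ⁿ`, and the theta model extends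

Part 1 (this file): the group.  `Heis.weylAut m hm : MulAut (Heis V)` (the Weyl automorphism `σ_m` of #6 as a
`MulEquiv`, inverse `σ³`), `Heis.weylAction m hm : Multiplicative ℤ →* MulAut (Heis V)` (`n ↦ σⁿ`), and the
semidirect product `HeisW V m hm := Heis V ⋊[weylAction] Multiplicative ℤ` — "the Heisenberg group with the Weyl
element adjoined" — with its topology (product of `Heis V` and the discrete `ℤ`) making it a topological group;
`HeisW.center`, centrality of `inl (center z)`.
-/

set_option autoImplicit false

noncomputable section

open Topology MeasureTheory
open scoped RealInnerProductSpace FourierTransform SchwartzMap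

namespace HodgeCM
namespace SchwartzWeil

namespace Heis

variable {V : Type*} [NormedAddCommGroup V] [InnerProductSpace ℝ V] (m : ℤ) (hm : m ≠ 0)

/-- (Ported verbatim from the HodgeCMPerL package; no docstring in the source.) -/
theorem continuous_weyl : Continuous (weyl m hm : Heis V → Heis V) :=
  continuous_mk (continuous_b.const_smul _) ((continuous_a.const_smul _).neg)
    (continuous_u.mul (Real.continuous_fourierChar.comp (continuous_a.inner continuous_b)))

/-- `σ⁴ = 1`. -/
theorem weyl_weyl_weyl_weyl (h : Heis V) : weyl m hm (weyl m hm (weyl m hm (weyl m hm h))) = h := by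
  rw [weyl_weyl, weyl_weyl]
  ext <;> simp only [neg_neg]

/-- **The Weyl automorphism as an element of `MulAut (Heis V)`** (inverse `σ³`). -/
def weylAut : MulAut (Heis V) :=
  MulEquiv.mk'
    { toFun := weyl m hm
      invFun := fun h => weyl m hm (weyl m hm (weyl m hm h))
      left_inv := fun h => weyl_weyl_weyl_weyl m hm h
      right_inv := fun h => weyl_weyl_weyl_weyl m hm h }
    (map_mul (weyl m hm))

/-- (Ported verbatim from the HodgeCMPerL package; no docstring in the source.) -/
@[simp] theorem weylAut_apply (h : Heis V) : weylAut m hm h = weyl m hm h := rfl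

/-- (Ported verbatim from the HodgeCMPerL package; no docstring in the source.) -/
theorem weylAut_symm_apply (h : Heis V) :
    (weylAut m hm).symm h = weyl m hm (weyl m hm (weyl m hm h)) := rfl

/-- `n ↦ σⁿ`. -/
def weylAction : Multiplicative ℤ →* MulAut (Heis V) := zpowersHom (MulAut (Heis V)) (weylAut m hm)

/-- (Ported verbatim from the HodgeCMPerL package; no docstring in the source.) -/
theorem weylAction_apply (n : Multiplicative ℤ) :
    (weylAction m hm n : MulAut (Heis V)) = weylAut m hm ^ n.toAdd :=
  zpowersHom_apply _ _ _

/-- (Ported verbatim from the HodgeCMPerL package; no docstring in the source.) -/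
@[simp] theorem weylAction_ofAdd_one :
    (weylAction m hm (Multiplicative.ofAdd 1) : MulAut (Heis V)) = weylAut m hm := by
  rw [weylAction_apply, toAdd_ofAdd, zpow_one]

/-- Every `σⁿ` is continuous. -/
theorem continuous_weylAction (n : Multiplicative ℤ) : Continuous (weylAction m hm n : Heis V → Heis V) := by
  rw [weylAction_apply]
  refine zpow_induction_left (g := weylAut m hm) (P := fun e : MulAut (Heis V) => Continuous (e : Heis V → Heis V))
    continuous_id (fun e he => ?_) (fun e he => ?_) n.toAdd
  · rw [MulAut.coe_mul]
    exact (continuous_weyl m hm).comp he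
  · rw [MulAut.coe_mul, MulAut.inv_def]
    have h3 : Continuous fun h : Heis V => (weylAut m hm).symm h := by
      simp only [weylAut_symm_apply]
      exact (continuous_weyl m hm).comp ((continuous_weyl m hm).comp (continuous_weyl m hm))
    exact h3.comp he

/-- Every `σⁿ` fixes the centre. -/
theorem weylAction_center (n : Multiplicative ℤ) (z : Circle) :
    weylAction m hm n (center z : Heis V) = center z := by
  rw [weylAction_apply]
  refine zpow_induction_left (g := weylAut m hm) (P := fun e : MulAut (Heis V) => e (center z) = center z) rfl
    (fun e he => ?_) (fun e he => ?_) n.toAdd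
  · simp only [MulAut.mul_apply, he, weylAut_apply, weyl_center]
  · simp only [MulAut.mul_apply, he, MulAut.inv_apply, weylAut_symm_apply, weyl_center]

end Heis

/-! ## The extended group `HeisW = Heis V ⋊ ℤ` -/

section Group

variable (V : Type*) [NormedAddCommGroup V] [InnerProductSpace ℝ V] (m : ℤ) (hm : m ≠ 0)

/-- **The Heisenberg group with the Weyl element adjoined**: `Heis V ⋊[σ] ℤ`. -/
abbrev HeisW : Type _ := Heis V ⋊[Heis.weylAction m hm] Multiplicative ℤ

namespace HeisW

variable {V m hm}

/-- The pair map to `Heis V × ℤ`. -/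
def toProd (x : HeisW V m hm) : Heis V × Multiplicative ℤ := (x.left, x.right)

/-- (Ported verbatim from the HodgeCMPerL package; no docstring in the source.) -/
theorem toProd_injective : Function.Injective (toProd : HeisW V m hm → Heis V × Multiplicative ℤ) := by
  intro x y h
  simp only [toProd, Prod.mk.injEq] at h
  exact SemidirectProduct.ext h.1 h.2

/-- (Ported verbatim from the HodgeCMPerL package; no docstring in the source.) -/
instance : TopologicalSpace (HeisW V m hm) := TopologicalSpace.induced toProd inferInstance

/-- (Ported verbatim from the HodgeCMPerL package; no docstring in the source.) -/
theorem continuous_toProd : Continuous (toProd : HeisW V m hm → Heis V × Multiplicative ℤ) :=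
  continuous_induced_dom

/-- (Ported verbatim from the HodgeCMPerL package; no docstring in the source.) -/
theorem continuous_left : Continuous fun x : HeisW V m hm => x.left := continuous_fst.comp continuous_toProd
/-- (Ported verbatim from the HodgeCMPerL package; no docstring in the source.) -/
theorem continuous_right : Continuous fun x : HeisW V m hm => x.right := continuous_snd.comp continuous_toProd

/-- (Ported verbatim from the HodgeCMPerL package; no docstring in the source.) -/
theorem continuous_mk {X : Type*} [TopologicalSpace X] {f : X → Heis V} {g : X → Multiplicative ℤ}
    (hf : Continuous f) (hg : Continuous g) : Continuous fun x => (⟨f x, g x⟩ : HeisW V m hm) :=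
  continuous_induced_rng.2 (hf.prodMk hg)

/-- (Ported verbatim from the HodgeCMPerL package; no docstring in the source.) -/
theorem isEmbedding_toProd : IsEmbedding (toProd : HeisW V m hm → Heis V × Multiplicative ℤ) :=
  ⟨⟨rfl⟩, toProd_injective⟩

/-- Joint continuity of the action map `(n, h) ↦ σⁿ h` (ℤ is discrete). -/
theorem continuous_action : Continuous fun p : Multiplicative ℤ × Heis V => Heis.weylAction m hm p.1 p.2 :=
  continuous_prod_of_discrete_left.mpr fun n => Heis.continuous_weylAction m hm n

/-- (Ported verbatim from the HodgeCMPerL package; no docstring in the source.) -/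
instance : IsTopologicalGroup (HeisW V m hm) where
  continuous_mul := by
    refine continuous_mk ?_ ((continuous_right.comp continuous_fst).mul (continuous_right.comp continuous_snd))
    exact (continuous_left.comp continuous_fst).mul
      ((continuous_action (V := V) (m := m) (hm := hm)).comp
        ((continuous_right.comp continuous_fst).prodMk (continuous_left.comp continuous_snd)))
  continuous_inv := by
    refine continuous_mk ?_ continuous_right.inv
    exact (continuous_action (V := V) (m := m) (hm := hm)).comp
      (continuous_right.inv.prodMk continuous_left.inv)

/-- The centre `z ↦ inl (0, 0, z)`. -/
def center : Circle →* HeisW V m hm := SemidirectProduct.inl.comp Heis.center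

/-- (Ported verbatim from the HodgeCMPerL package; no docstring in the source.) -/
theorem center_apply (z : Circle) : (center z : HeisW V m hm) = SemidirectProduct.inl (Heis.center z) := rfl

/-- (Ported verbatim from the HodgeCMPerL package; no docstring in the source.) -/
theorem continuous_center : Continuous (center : Circle → HeisW V m hm) :=
  continuous_mk (Heis.continuous_mk continuous_const continuous_const continuous_id) continuous_const

/-- `inl (center z)` is central in `HeisW`. -/
theorem center_mul_comm (z : Circle) (x : HeisW V m hm) : center z * x = x * center z := by
  rw [center_apply, ← SemidirectProduct.inl_left_mul_inr_right x, ← mul_assoc, ← map_mul, Heis.center_mul_comm,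
    map_mul, mul_assoc, mul_assoc]
  congr 1
  refine SemidirectProduct.ext ?_ ?_
  · simp only [SemidirectProduct.mul_left, SemidirectProduct.left_inr, SemidirectProduct.left_inl,
      SemidirectProduct.right_inr, SemidirectProduct.right_inl, one_mul, mul_one, map_one,
      Heis.weylAction_center]
  · simp only [SemidirectProduct.mul_right, SemidirectProduct.right_inr, SemidirectProduct.right_inl, mul_one,
      one_mul]

end HeisW

end Group


/-! ## The representation `ρ̃_m` of `HeisW` on `𝓢(V, ℂ)`: `(h, σⁿ) ↦ ρ_m(h) ∘ 𝓕ⁿ` -/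

section Rep

variable (V : Type) [NormedAddCommGroup V] [InnerProductSpace ℝ V] [FiniteDimensional ℝ V] [MeasurableSpace V]
  [BorelSpace V] (m : ℤ) (hm : m ≠ 0)

/-- The Fourier transform of `𝓢(V, ℂ)` as a unit of `End(𝓢(V, ℂ))`. -/
def fourierUnit : (𝓢(V, ℂ) →L[ℂ] 𝓢(V, ℂ))ˣ := (FourierTransform.fourierCLE ℂ (𝓢(V, ℂ))).toUnit

/-- (Ported verbatim from the HodgeCMPerL package; no docstring in the source.) -/
@[simp] theorem fourierUnit_apply (Φ : 𝓢(V, ℂ)) :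
    (fourierUnit V : 𝓢(V, ℂ) →L[ℂ] 𝓢(V, ℂ)) Φ = 𝓕 Φ := rfl

/-- (Ported verbatim from the HodgeCMPerL package; no docstring in the source.) -/
@[simp] theorem fourierUnit_inv_apply (Φ : 𝓢(V, ℂ)) :
    (((fourierUnit V)⁻¹ : (𝓢(V, ℂ) →L[ℂ] 𝓢(V, ℂ))ˣ) : 𝓢(V, ℂ) →L[ℂ] 𝓢(V, ℂ)) Φ = 𝓕⁻ Φ := rfl

omit [FiniteDimensional ℝ V] [MeasurableSpace V] [BorelSpace V] in
/-- (Ported verbatim from the HodgeCMPerL package; no docstring in the source.) -/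
theorem units_apply_inv_apply (u : (𝓢(V, ℂ) →L[ℂ] 𝓢(V, ℂ))ˣ) (Φ : 𝓢(V, ℂ)) :
    (u : 𝓢(V, ℂ) →L[ℂ] 𝓢(V, ℂ)) (((u⁻¹ : (𝓢(V, ℂ) →L[ℂ] 𝓢(V, ℂ))ˣ) : 𝓢(V, ℂ) →L[ℂ] 𝓢(V, ℂ)) Φ) = Φ := by
  rw [← mul_apply_eq_comp, Units.mul_inv, one_apply_eq_self]

/-- `𝓕⁻ ∘ ρ_m(h) = ρ_m(σ⁻¹ h) ∘ 𝓕⁻`. -/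
theorem fourierInv_repCLM (h : Heis V) (Φ : 𝓢(V, ℂ)) :
    𝓕⁻ (repCLM V m h Φ) = repCLM V m ((Heis.weylAut m hm).symm h) (𝓕⁻ Φ) := by
  have e := fourier_repCLM V m hm ((Heis.weylAut m hm).symm h) (𝓕⁻ Φ)
  rw [FourierTransform.fourier_fourierInv_eq, ← Heis.weylAut_apply m hm, MulEquiv.apply_symm_apply] at e
  rw [← e, FourierTransform.fourierInv_fourier_eq]

/-- **`𝓕ⁿ ∘ ρ_m(h) = ρ_m(σⁿ h) ∘ 𝓕ⁿ` for every `n : ℤ`.** -/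
theorem fourierUnit_zpow_repCLM (n : ℤ) (h : Heis V) (Φ : 𝓢(V, ℂ)) :
    ((fourierUnit V ^ n : (𝓢(V, ℂ) →L[ℂ] 𝓢(V, ℂ))ˣ) : 𝓢(V, ℂ) →L[ℂ] 𝓢(V, ℂ)) (repCLM V m h Φ) =
      repCLM V m ((Heis.weylAut m hm ^ n) h)
        (((fourierUnit V ^ n : (𝓢(V, ℂ) →L[ℂ] 𝓢(V, ℂ))ˣ) : 𝓢(V, ℂ) →L[ℂ] 𝓢(V, ℂ)) Φ) := by
  induction n using Int.induction_on generalizing h Φ with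
  | zero => simp only [zpow_zero, Units.val_one, one_apply_eq_self, MulAut.one_apply]
  | succ i ih =>
    simp only [zpow_add_one, Units.val_mul, mul_apply_eq_comp, MulAut.mul_apply, fourierUnit_apply,
      Heis.weylAut_apply, fourier_repCLM V m hm, ih]
  | pred i ih =>
    simp only [zpow_sub_one, Units.val_mul, mul_apply_eq_comp, MulAut.mul_apply, MulAut.inv_apply,
      fourierUnit_inv_apply, fourierInv_repCLM V m hm, ih]

/-- `ρ_m` with values in the units of `End(𝓢(V, ℂ))`. -/
def repUnits : Heis V →* (𝓢(V, ℂ) →L[ℂ] 𝓢(V, ℂ))ˣ := (rep V m).toHomUnits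

/-- (Ported verbatim from the HodgeCMPerL package; no docstring in the source.) -/
@[simp] theorem val_repUnits (h : Heis V) :
    (repUnits V m h : 𝓢(V, ℂ) →L[ℂ] 𝓢(V, ℂ)) = repCLM V m h := rfl

/-- `n ↦ 𝓕ⁿ`. -/
def fourierPow : Multiplicative ℤ →* (𝓢(V, ℂ) →L[ℂ] 𝓢(V, ℂ))ˣ :=
  zpowersHom (𝓢(V, ℂ) →L[ℂ] 𝓢(V, ℂ))ˣ (fourierUnit V)

/-- (Ported verbatim from the HodgeCMPerL package; no docstring in the source.) -/
theorem fourierPow_apply (n : Multiplicative ℤ) : fourierPow V n = fourierUnit V ^ n.toAdd := zpowersHom_apply _ _ _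

/-- The semidirect-product compatibility: `ρ_m ∘ σⁿ = conj(𝓕ⁿ) ∘ ρ_m`. -/
theorem repUnits_comp_weylAction (n : Multiplicative ℤ) :
    (repUnits V m).comp (Heis.weylAction m hm n).toMonoidHom =
      (MulAut.conj (fourierPow V n)).toMonoidHom.comp (repUnits V m) := by
  refine MonoidHom.ext fun h => Units.ext ?_
  simp only [MonoidHom.comp_apply, MulEquiv.coe_toMonoidHom, MulAut.conj_apply, Units.val_mul, val_repUnits,
    fourierPow_apply, Heis.weylAction_apply]
  refine ContinuousLinearMap.ext fun Φ => ?_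
  rw [mul_apply_eq_comp, mul_apply_eq_comp, fourierUnit_zpow_repCLM V m hm, units_apply_inv_apply]

/-- **The representation `ρ̃_m` of `HeisW = Heis V ⋊ ⟨σ⟩` on `𝓢(V, ℂ)`**: `ρ̃_m(h, σⁿ) = ρ_m(h) ∘ 𝓕ⁿ`. -/
def repW : HeisW V m hm →* (𝓢(V, ℂ) →L[ℂ] 𝓢(V, ℂ))ˣ :=
  SemidirectProduct.lift (repUnits V m) (fourierPow V) (repUnits_comp_weylAction V m hm)

/-- (Ported verbatim from the HodgeCMPerL package; no docstring in the source.) -/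
theorem repW_apply (x : HeisW V m hm) : repW V m hm x = repUnits V m x.left * fourierPow V x.right := rfl

/-- (Ported verbatim from the HodgeCMPerL package; no docstring in the source.) -/
theorem repW_val_apply (x : HeisW V m hm) (Φ : 𝓢(V, ℂ)) :
    (repW V m hm x : 𝓢(V, ℂ) →L[ℂ] 𝓢(V, ℂ)) Φ =
      repCLM V m x.left (((fourierUnit V ^ x.right.toAdd : (𝓢(V, ℂ) →L[ℂ] 𝓢(V, ℂ))ˣ) : 𝓢(V, ℂ) →L[ℂ] 𝓢(V, ℂ)) Φ) := by
  rw [repW_apply, Units.val_mul, mul_apply_eq_comp, val_repUnits, fourierPow_apply]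

/-- (Ported verbatim from the HodgeCMPerL package; no docstring in the source.) -/
@[simp] theorem repW_inl_apply (h : Heis V) (Φ : 𝓢(V, ℂ)) :
    (repW V m hm (SemidirectProduct.inl h) : 𝓢(V, ℂ) →L[ℂ] 𝓢(V, ℂ)) Φ = repCLM V m h Φ := by
  rw [repW, SemidirectProduct.lift_inl, val_repUnits]

/-- **The adjoined Weyl element acts by the Fourier transform.** -/
@[simp] theorem repW_weyl_apply (Φ : 𝓢(V, ℂ)) :
    (repW V m hm (SemidirectProduct.inr (Multiplicative.ofAdd 1)) : 𝓢(V, ℂ) →L[ℂ] 𝓢(V, ℂ)) Φ = 𝓕 Φ := by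
  rw [repW, SemidirectProduct.lift_inr, fourierPow_apply, toAdd_ofAdd, zpow_one, fourierUnit_apply]

/-- (Ported verbatim from the HodgeCMPerL package; no docstring in the source.) -/
theorem repW_inr_apply (n : Multiplicative ℤ) (Φ : 𝓢(V, ℂ)) :
    (repW V m hm (SemidirectProduct.inr n) : 𝓢(V, ℂ) →L[ℂ] 𝓢(V, ℂ)) Φ =
      (((fourierUnit V ^ n.toAdd : (𝓢(V, ℂ) →L[ℂ] 𝓢(V, ℂ))ˣ)) : 𝓢(V, ℂ) →L[ℂ] 𝓢(V, ℂ)) Φ := by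
  rw [repW, SemidirectProduct.lift_inr, fourierPow_apply]

/-- (Ported verbatim from the HodgeCMPerL package; no docstring in the source.) -/
theorem repW_one_apply (Φ : 𝓢(V, ℂ)) : (repW V m hm 1 : 𝓢(V, ℂ) →L[ℂ] 𝓢(V, ℂ)) Φ = Φ := by
  rw [map_one, Units.val_one, one_apply_eq_self]

/-- (Ported verbatim from the HodgeCMPerL package; no docstring in the source.) -/
theorem repW_mul_apply (x y : HeisW V m hm) (Φ : 𝓢(V, ℂ)) :
    (repW V m hm (x * y) : 𝓢(V, ℂ) →L[ℂ] 𝓢(V, ℂ)) Φ =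
      (repW V m hm x : 𝓢(V, ℂ) →L[ℂ] 𝓢(V, ℂ)) ((repW V m hm y : 𝓢(V, ℂ) →L[ℂ] 𝓢(V, ℂ)) Φ) := by
  rw [map_mul, Units.val_mul, mul_apply_eq_comp]

/-- **Joint continuity of `(x, Φ) ↦ ρ̃_m(x) Φ`** on `HeisW × 𝓢(V, ℂ)` (`ℤ` is discrete; `ρ_m` is jointly continuous, #5). -/
theorem continuous_repW_uncurry :
    Continuous (Function.uncurry fun (x : HeisW V m hm) (Φ : 𝓢(V, ℂ)) => (repW V m hm x : 𝓢(V, ℂ) →L[ℂ] 𝓢(V, ℂ)) Φ) := by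
  have hF : Continuous fun p : Multiplicative ℤ × (Heis V × 𝓢(V, ℂ)) =>
      repCLM V m p.2.1 ((((fourierUnit V ^ p.1.toAdd : (𝓢(V, ℂ) →L[ℂ] 𝓢(V, ℂ))ˣ)) : 𝓢(V, ℂ) →L[ℂ] 𝓢(V, ℂ)) p.2.2) := by
    refine continuous_prod_of_discrete_left.mpr fun n => ?_
    have h := (continuous_repCLM_uncurry V m).comp
      ((continuous_fst (X := Heis V) (Y := 𝓢(V, ℂ))).prodMk
        ((((fourierUnit V ^ n.toAdd : (𝓢(V, ℂ) →L[ℂ] 𝓢(V, ℂ))ˣ)) : 𝓢(V, ℂ) →L[ℂ] 𝓢(V, ℂ)).continuous.comp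
          (continuous_snd (X := Heis V) (Y := 𝓢(V, ℂ)))))
    dsimp only [Function.comp_def, Function.uncurry_def] at h
    exact h
  have h := hF.comp (((HeisW.continuous_right (V := V) (m := m) (hm := hm)).comp continuous_fst).prodMk
    (((HeisW.continuous_left (V := V) (m := m) (hm := hm)).comp continuous_fst).prodMk
      (continuous_snd (X := HeisW V m hm) (Y := 𝓢(V, ℂ)))))
  dsimp only [Function.comp_def] at h
  simp only [Function.uncurry_def, repW_val_apply]
  exact h

end Rep

/-! ## Weil's theta function on `HeisW` and its invariance -/

section Theta

variable (V : Type) [NormedAddCommGroup V] [InnerProductSpace ℝ V] [FiniteDimensional ℝ V] [MeasurableSpace V]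
  [BorelSpace V] (L : Submodule ℤ V) (m : ℤ) (hm : m ≠ 0)

/-- **Weil's theta function on the extended group**: `Θ̃_Φ(x) := Θ_{ρ̃(x)Φ}(1) = Σ_{v ∈ L} (ρ̃_m(x) Φ)(v)`. -/
def thetaW (Φ : 𝓢(V, ℂ)) (x : HeisW V m hm) : ℂ := thetaH V L m ((repW V m hm x : 𝓢(V, ℂ) →L[ℂ] 𝓢(V, ℂ)) Φ) 1

/-- (Ported verbatim from the HodgeCMPerL package; no docstring in the source.) -/
theorem thetaW_def (Φ : 𝓢(V, ℂ)) (x : HeisW V m hm) :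
    thetaW V L m hm Φ x = thetaH V L m ((repW V m hm x : 𝓢(V, ℂ) →L[ℂ] 𝓢(V, ℂ)) Φ) 1 := rfl

/-- `Θ̃_Φ(h, σⁿ) = Θ_{𝓕ⁿ Φ}(h)`. -/
theorem thetaW_eq (Φ : 𝓢(V, ℂ)) (x : HeisW V m hm) :
    thetaW V L m hm Φ x =
      thetaH V L m ((((fourierUnit V ^ x.right.toAdd : (𝓢(V, ℂ) →L[ℂ] 𝓢(V, ℂ))ˣ)) : 𝓢(V, ℂ) →L[ℂ] 𝓢(V, ℂ)) Φ) x.left := by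
  rw [thetaW, repW_val_apply, thetaH_repCLM, one_mul]

/-- On the Heisenberg group it is `Θ` of #5. -/
@[simp] theorem thetaW_inl (Φ : 𝓢(V, ℂ)) (h : Heis V) :
    thetaW V L m hm Φ (SemidirectProduct.inl h) = thetaH V L m Φ h := by
  rw [thetaW, repW_inl_apply, thetaH_repCLM, one_mul]

/-- At the Weyl element it is `Θ_{𝓕Φ}`. -/
theorem thetaW_inl_mul_weyl (Φ : 𝓢(V, ℂ)) (h : Heis V) :
    thetaW V L m hm Φ (SemidirectProduct.inl h * SemidirectProduct.inr (Multiplicative.ofAdd 1)) =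
      thetaH V L m (𝓕 Φ) h := by
  rw [thetaW, repW_mul_apply, repW_weyl_apply, repW_inl_apply, thetaH_repCLM, one_mul]

/-- The `theta_act` law: `Θ̃_{ρ̃(g)Φ}(x) = Θ̃_Φ(x g)`. -/
theorem thetaW_repW (Φ : 𝓢(V, ℂ)) (x g : HeisW V m hm) :
    thetaW V L m hm ((repW V m hm g : 𝓢(V, ℂ) →L[ℂ] 𝓢(V, ℂ)) Φ) x = thetaW V L m hm Φ (x * g) := by
  rw [thetaW, thetaW, repW_mul_apply]

/-- The stabiliser of the theta distribution `Φ ↦ Θ_Φ(1)` under `ρ̃_m`. -/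
def thetaStab : Subgroup (HeisW V m hm) where
  carrier := {x | ∀ Ψ : 𝓢(V, ℂ), thetaH V L m ((repW V m hm x : 𝓢(V, ℂ) →L[ℂ] 𝓢(V, ℂ)) Ψ) 1 = thetaH V L m Ψ 1}
  one_mem' Ψ := by rw [repW_one_apply]
  mul_mem' {x y} hx hy Ψ := by rw [repW_mul_apply, hx, hy]
  inv_mem' {x} hx Ψ := by
    rw [← hx ((repW V m hm x⁻¹ : 𝓢(V, ℂ) →L[ℂ] 𝓢(V, ℂ)) Ψ), ← repW_mul_apply, mul_inv_cancel, repW_one_apply]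

/-- (Ported verbatim from the HodgeCMPerL package; no docstring in the source.) -/
theorem mem_thetaStab {x : HeisW V m hm} :
    x ∈ thetaStab V L m hm ↔
      ∀ Ψ : 𝓢(V, ℂ), thetaH V L m ((repW V m hm x : 𝓢(V, ℂ) →L[ℂ] 𝓢(V, ℂ)) Ψ) 1 = thetaH V L m Ψ 1 :=
  Iff.rfl

/-- Left invariance of `Θ̃` under the stabiliser. -/
theorem thetaW_stab_mul (Φ : 𝓢(V, ℂ)) {γ : HeisW V m hm} (hγ : γ ∈ thetaStab V L m hm) (x : HeisW V m hm) :
    thetaW V L m hm Φ (γ * x) = thetaW V L m hm Φ x := by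
  rw [thetaW, thetaW, repW_mul_apply, hγ]

/-- `arith ≤ stabiliser` (Weil's Théorème 6 for the Heisenberg part, #5). -/
theorem inl_mem_thetaStab {γ : Heis V} (hγ : γ ∈ arith V L m) :
    (SemidirectProduct.inl γ : HeisW V m hm) ∈ thetaStab V L m hm := fun Ψ => by
  rw [repW_inl_apply, thetaH_repCLM, one_mul, ← mul_one γ, thetaH_arith_mul V L m Ψ hγ]

/-- **The arithmetic subgroup of the extended group**: generated by `arith(L, m)` and the Weyl element. -/
def arithW : Subgroup (HeisW V m hm) :=
  (arith V L m).map (SemidirectProduct.inl : Heis V →* HeisW V m hm) ⊔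
    Subgroup.zpowers (SemidirectProduct.inl (1 : Heis V) * SemidirectProduct.inr (Multiplicative.ofAdd 1))

omit [FiniteDimensional ℝ V] [MeasurableSpace V] [BorelSpace V] in
/-- (Ported verbatim from the HodgeCMPerL package; no docstring in the source.) -/
theorem inl_mem_arithW {γ : Heis V} (hγ : γ ∈ arith V L m) :
    (SemidirectProduct.inl γ : HeisW V m hm) ∈ arithW V L m hm :=
  Subgroup.mem_sup_left (Subgroup.mem_map_of_mem _ hγ)


-- port_pkg: scope closed for this part
end Theta
end SchwartzWeil
end HodgeCM
end
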